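import Mathlib
import HarnessLib
import Literature.Topology.FourManifolds.SPC4Wave0
import Literature.AlgebraicTopology.SingularHomology.SingularChains
import Literature.Geometry.Kaehler.ManifoldFormsPullback
import Literature.NumberTheory.Transcendental.DeRhamTheoremProofs
import Literature.NumberTheory.Transcendental.FormIntegrationStokes
import Literature.NumberTheory.Transcendental.FormIntegrationPositivity
import Literature.NumberTheory.Transcendental.FormIntegrationPullbackCharts
import Literature.Geometry.Symplectic.SymplecticOrientation
import Literature.AlgebraicTopology.SingularHomology.OrientationProofs
import Literature.AlgebraicTopology.SingularHomology.GysinMap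
import Literature.AlgebraicTopology.SingularHomology.GysinMapSupportProofs
import Literature.AlgebraicTopology.SingularHomology.PoincareDualityProofs
import Literature.AlgebraicTopology.SingularHomology.PoincareDualityCorollaries
import Literature.AlgebraicTopology.SingularHomology.IntegralClassRingChange
import Literature.AlgebraicTopology.SingularHomology.BettiNumberBaseChange
import Literature.AlgebraicTopology.SingularHomology.IntersectionFormProofs
import Literature.AlgebraicTopology.SingularHomology.UniversalCoefficientsField
import Literature.AlgebraicTopology.SingularHomology.CohomologyOfFiniteDiscrete

/-!
# Stub `stub_rankOneFlatComplement` of line `canonical-cap-filling` for crux `NoGenusTwoDoor`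
(stmt-SmoothPoincare4-7842, route SymplecticOrigami) — PROVED, no named facts

**Statement (S2, rank-one flat complement).** For a closed connected symplectic `4`-manifold
`(N, s)` (`s : MForm`, chartwise smooth, closed, pointwise non-degenerate) with
`rank H₂(N; ℤ) = 1` and any smoothly embedded compact connected `s`-symplectic surface
`B = b(S)`: (i) `s|_U = dθ` for a smooth `1`-form `θ` on the open submanifold `U = N ∖ B`;
(ii) every class in the image of `H₂(N ∖ B; ℤ) → H₂(N; ℤ)` has finite order.

**Proof.** `H²(N; ℝ)` is a line (`b₂(ℤ) = b₂(ℚ) = b₂(ℝ) = dim H²(N; ℝ)`, universal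
coefficients).  `N` and `S` are `ℤ`-, hence `ℝ`-oriented (symplectic orientations,
`Literature.Geometry.Symplectic.SymplecticOrientation`).  The real Poincaré dual `τ = b_! 1` of
`b_*[S]` (Gysin map) restricts to zero on `N ∖ B` (`gysinMap_restrictCompl_eq_zero_of_field`,
Fulton App. B), and `τ ≠ 0`: with de Rham's theorem (the tree's integration isomorphisms
`integrationDeRhamIsoFamily`, natural — here also across model spaces) the class `[s]` pairs with
`b_*[S] = τ ⌢ [N]` to `⟨[b^* s], [S]⟩`, non-zero since the nowhere-vanishing area form `b^* s`
is not exact (Stokes: `∫_S b^* s ≠ 0` for the orientation it defines) and `H²(S; ℝ)` is detected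
by `[S]`.  Hence the restriction `H²(N; ℝ) → H²(N ∖ B; ℝ)` is ZERO.  (i): the de Rham class of
`s|_U` goes to `[s]|_U = 0`, so `s|_U` is exact.  (ii): a non-torsion `x = ι_* z ∈ H₂(N; ℤ)` has
an integral class `β` with `⟨β, x⟩ ≠ 0` (Poincaré duality and unimodularity over `ℤ`), so
`⟨ι^* β, z⟩ ≠ 0` and `(ι^* β) ⊗ ℝ = ι^*(β ⊗ ℝ) ≠ 0`, contradicting the vanishing restriction.
Compactness of `N` enters through Poincaré duality and finite generation.

Sources: McDuff–Salamon (2017) §2.1, Ex. 4.4.5; Bott–Tu (1982) §I.5–6; Lee (2013) Thm. 18.14,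
Prop. 15.5, 16.6, Cor. 16.13; Hatcher (2002) §3.3 Thm. 3.30, Prop. 3.38, §3.1 p. 198;
Fulton (1997) App. B §B.2.
-/

noncomputable section
set_option linter.dupNamespace false
open scoped Manifold ContDiff Topology ContinuousMap
open Set Function TopologicalSpace
open Literature.Geometry.Kaehler (MForm IsSmoothForm IsClosedForm mextDeriv)
open Literature.AlgebraicTopology.SingularHomology
open Literature.Topology.FourManifolds (singularHomologyZ)

namespace Summit.SmoothPoincare4.SmoothPoincare4.Theorems.NoGenusTwoDoor.CanonicalCapFilling

section DeRhamNatural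

open CategoryTheory Literature.Geometry.Manifold Literature.NumberTheory.Transcendental
  Literature.Geometry.Kaehler

-- see "Implementation notes" in `…SingularHomology.SingularChainsConcrete`
set_option backward.isDefEq.respectTransparency false

universe u

variable {E : Type u} [NormedAddCommGroup E] [NormedSpace ℝ E] [FiniteDimensional ℝ E]
  {E' : Type u} [NormedAddCommGroup E'] [NormedSpace ℝ E'] [FiniteDimensional ℝ E']
  {M : Type u} [TopologicalSpace M] [ChartedSpace E M] [IsManifold 𝓘(ℝ, E) ∞ M] [T2Space M]
  [SecondCountableTopology M] [LocallyCompactSpace M]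
  {N : Type u} [TopologicalSpace N] [ChartedSpace E' N] [IsManifold 𝓘(ℝ, E') ∞ N] [T2Space N]
  [SecondCountableTopology N] [LocallyCompactSpace N]

/-- **Naturality of the de Rham comparison isomorphism under `C^∞` maps between manifolds with
possibly different model spaces** (Lee (2013), Thm. 18.14; the tree's
`homologyMap_pullbackUniv_comp_deRhamComparisonIso` is the equal-model case, same proof).
[cite: LeeSmoothManifolds2013, Thm. 18.14] -/
theorem homologyMap_pullbackUniv_comp_deRhamComparisonIso' {f : M → N}
    (hf : ContMDiff 𝓘(ℝ, E) 𝓘(ℝ, E') ∞ f) (k : ℕ) :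
    HomologicalComplex.homologyMap (localDeRhamComplex.pullbackUniv 𝓘(ℝ, E) hf) k ≫
        (deRhamComparisonIso 𝓘(ℝ, E) M k).hom =
      (deRhamComparisonIso 𝓘(ℝ, E') N k).hom ≫ singularCohomology.map ℝ ℝ ⟨f, hf.continuous⟩ k := by
  haveI := isIso_homologyMap_toSmoothAll (I := 𝓘(ℝ, E)) (M := M) k
  rw [← cancel_mono (HomologicalComplex.homologyMap (singIso M).hom k ≫
      HomologicalComplex.homologyMap (toSmoothAll 𝓘(ℝ, E) M) k),
    Category.assoc, deRhamComparisonIso_hom_comp, ← HomologicalComplex.homologyMap_comp,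
    pullbackUniv_comp_deRhamMap, HomologicalComplex.homologyMap_comp]
  change _ = _ ≫
    HomologicalComplex.homologyMap (singularCochainComplex.map ℝ ℝ ⟨f, hf.continuous⟩) k ≫ _ ≫ _
  rw [← HomologicalComplex.homologyMap_comp_assoc, singIso_hom_naturality,
    HomologicalComplex.homologyMap_comp_assoc,
    ← HomologicalComplex.homologyMap_comp (dualMap ℝ realCoeff
      (csingularChainComplex.map ℝ ℝ ⟨f, hf.continuous⟩)) (toSmoothAll 𝓘(ℝ, E) M) k,
    ← toSmoothAll_naturality hf, HomologicalComplex.homologyMap_comp,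
    deRhamComparisonIso_hom_comp_assoc]

/-- **The integration isomorphisms `H^k_dR ≃ Hᵏ(·; ℝ)` are natural for `C^∞` maps between
manifolds with different model spaces**: `e_M (f^* c) = f^* (e_N c)` (Lee (2013), Thm. 18.14).
[cite: LeeSmoothManifolds2013, Thm. 18.14] -/
theorem integrationDeRhamIsoFamily_map [SigmaCompactSpace M] [SigmaCompactSpace N] {f : M → N}
    (hf : ContMDiff 𝓘(ℝ, E) 𝓘(ℝ, E') ∞ f) (k : ℕ) (c : deRhamCohomology 𝓘(ℝ, E') N ℝ k) :
    integrationDeRhamIsoFamily E M k (deRhamCohomology.map hf k c) =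
      singularCohomology.map ℝ ℝ ⟨f, hf.continuous⟩ k (integrationDeRhamIsoFamily E' N k c) := by
  rw [integrationDeRhamIsoFamily_apply, integrationDeRhamIsoFamily_apply]
  change (deRhamComparisonIso 𝓘(ℝ, E) M k).hom
      (deRhamToLocal 𝓘(ℝ, E) M ℝ k (deRhamCohomology.map hf k c)) =
    singularCohomology.map ℝ ℝ ⟨f, hf.continuous⟩ k
      ((deRhamComparisonIso 𝓘(ℝ, E') N k).hom (deRhamToLocal 𝓘(ℝ, E') N ℝ k c))
  rw [deRhamToLocal_map, ← ModuleCat.comp_apply, ← ModuleCat.comp_apply,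
    homologyMap_pullbackUniv_comp_deRhamComparisonIso' hf k]

end DeRhamNatural

section TopForm

open scoped EuclideanSpace
open Filter Module Literature.NumberTheory.Transcendental Literature.Geometry.Kaehler

variable {n : ℕ} {M : Type*} [TopologicalSpace M] [ChartedSpace (EuclideanSpace ℝ (Fin n)) M]
  [IsManifold (𝓡 n) ∞ M]

/-- **A nowhere-vanishing smooth top-degree form on a compact manifold is not exact**
(Lee (2013), Prop. 15.5, Prop. 16.6(c), Cor. 16.13: the form orients `M` — here by the ray of
the form itself, continuous since the chart representative of a smooth form is continuous at
the centre — its integral is then positive (`MForm.integral_pos_of_sign_mul_apply_nonneg`),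
while exact forms integrate to zero by Stokes
(`MForm.integral_eq_zero_of_mem_exactSmoothForms_holds`)).
[cite: LeeSmoothManifolds2013, Prop. 15.5 and Prop. 16.6] -/
theorem not_mem_exactSmoothForms_of_forall_ne_zero [T2Space M] [CompactSpace M] [Nonempty M]
    {t : MForm (𝓡 n) M ℝ n} (ht : IsSmoothForm t) (hne : ∀ x, t x ≠ 0) :
    t ∉ exactSmoothForms (𝓡 n) M ℝ n := by
  set e : Module.Basis (Fin n) ℝ (EuclideanSpace ℝ (Fin n)) :=
    modelBasis (EuclideanSpace ℝ (Fin n)) n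
  -- the form is non-zero on the reference frame and as an alternating map
  have hc : ∀ x, t x ⇑e ≠ 0 := fun x h ↦ hne x <| by
    have h2 : (t x).toAlternatingMap = 0 :=
      (AlternatingMap.map_basis_eq_zero_iff e (t x).toAlternatingMap).1 h
    exact ContinuousAlternatingMap.toAlternatingMap_injective
      (h2.trans ContinuousAlternatingMap.toAlternatingMap_zero.symm)
  have h0 : ∀ x, (t x).toAlternatingMap ≠ 0 := fun x h ↦
    hne x (ContinuousAlternatingMap.toAlternatingMap_injective
      (h.trans ContinuousAlternatingMap.toAlternatingMap_zero.symm))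
  -- the orientation family of the form
  set o : (x : M) → Orientation ℝ (TangentSpace (𝓡 n) x) (Fin n) :=
    fun x ↦ rayOfNeZero ℝ _ (h0 x) with ho_def
  have hsign : ∀ (x₀ : M) (y : EuclideanSpace ℝ (Fin n)),
      chartSign o x₀ y = Real.sign (t.inChart x₀ y ⇑e) := by
    intro x₀ y
    simp only [ho_def, chartSign]
    rw [sign_someVector_rayOfNeZero]
    rfl
  have hsign' : ∀ x : M,
      Real.sign (orientationForm o x ⇑e) = Real.sign (t x ⇑e) := fun x ↦
    sign_someVector_rayOfNeZero (t x).toAlternatingMap (h0 x) ⇑e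
  -- continuity of the orientation family
  have ho : IsContinuousOrientation o := by
    intro x₀
    have hg : ContinuousWithinAt (fun y ↦ t.inChart x₀ y ⇑e) (range (𝓡 n))
        (extChartAt (𝓡 n) x₀ x₀) :=
      (continuous_eval_const (⇑e : Fin n → EuclideanSpace ℝ (Fin n))).continuousAt
        |>.comp_continuousWithinAt (ht x₀).continuousWithinAt
    have hg0 : t.inChart x₀ (extChartAt (𝓡 n) x₀ x₀) ⇑e ≠ 0 := by
      rw [MForm.inChart_apply_self]
      exact hc x₀
    have hev : ∀ᶠ y in 𝓝[range (𝓡 n)] (extChartAt (𝓡 n) x₀ x₀),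
        0 < t.inChart x₀ y ⇑(modelBasis (EuclideanSpace ℝ (Fin n)) n) *
          t.inChart x₀ (extChartAt (𝓡 n) x₀ x₀) ⇑(modelBasis (EuclideanSpace ℝ (Fin n)) n) :=
      (hg.tendsto.mul_const _).eventually (lt_mem_nhds (mul_self_pos.2 hg0))
    filter_upwards [hev] with y hy
    rw [hsign, hsign]
    rcases pos_and_pos_or_neg_and_neg_of_mul_pos hy with ⟨ha, hb⟩ | ⟨ha, hb⟩
    · rw [Real.sign_of_pos ha, Real.sign_of_pos hb]
      exact ⟨rfl, one_ne_zero⟩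
    · rw [Real.sign_of_neg ha, Real.sign_of_neg hb]
      exact ⟨rfl, neg_ne_zero.2 one_ne_zero⟩
  -- positivity of the integral, and Stokes
  have hpos : 0 < t.integral o := by
    refine MForm.integral_pos_of_sign_mul_apply_nonneg ho ht (fun x ↦ ?_) ?_
    · have h := abs_nonneg (t x ⇑(modelBasis (EuclideanSpace ℝ (Fin n)) n))
      rw [← real_sign_mul_self, ← hsign' x] at h
      exact h
    · obtain ⟨x⟩ := ‹Nonempty M›
      refine ⟨x, ?_⟩
      have h := abs_pos.2 (hc x)
      rw [← real_sign_mul_self, ← hsign' x] at h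
      exact h
  intro hex
  exact hpos.ne' (MForm.integral_eq_zero_of_mem_exactSmoothForms_holds o ho hex)

end TopForm

section Surface

/-- **On a closed connected `R`-oriented surface, `a ↦ ⟨a, [S]⟩` is injective on `H²(S; R)`**:
`⟨a, [S]⟩ = ε(a ⌢ [S])` with `a ↦ a ⌢ [S]` bijective (Poincaré duality, Hatcher 2002, Thm. 3.30,
the tree's `poincare_duality`) and `ε : H₀(S) → R` bijective for the path-connected `S`
(Prop. 2.7); cf. the tree's `bijective_kroneckerPairing_fundamentalClass_surface` over `ℤ`.
[cite: HatcherAT2002, §3.3 Thm. 3.30 and Prop. 2.7] -/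
theorem kroneckerPairing_fundamentalClass_injective_surface {R : Type} [CommRing R] {S : Type}
    [TopologicalSpace S] [T2Space S] [CompactSpace S] [ConnectedSpace S]
    [ChartedSpace (EuclideanSpace ℝ (Fin 2)) S] (μS : HomologicalOrientation R S 2) :
    Function.Injective (fun a : singularCohomology R R S 2 =>
      kroneckerPairing R R S 2 a μS.fundamentalClass) := by
  haveI := ChartedSpace.locallyPathConnectedSpace (EuclideanSpace ℝ (Fin 2)) S
  haveI : PathConnectedSpace S := pathConnectedSpace_iff_connectedSpace.mpr inferInstance
  haveI := singularHomology.isIso_ε_of_pathConnectedSpace R R (X := S)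
  have hPD : Function.Bijective (poincareDualityMap μS (Nat.add_zero 2)) :=
    poincare_duality μS (Nat.add_zero 2)
  have hε : Function.Bijective (singularHomology.ε R R S) :=
    (CategoryTheory.asIso (singularHomology.ε R R S)).toLinearEquiv.bijective
  have hd : Function.Injective (ULift.down : ULift.{0} R → R) := fun _ _ h => ULift.ext _ _ h
  exact hd.comp (hε.1.comp hPD.1)

end Surface

section Lemmas

/-- A de Rham class `[α]` vanishes only if `α` is exact (Warner (1983), Def. 4.11). [folklore] -/
theorem mem_exactSmoothForms_of_mk_eq_zero {E : Type*} [NormedAddCommGroup E] [NormedSpace ℝ E]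
    {H : Type*} [TopologicalSpace H] {I : ModelWithCorners ℝ E H} {M : Type*} [TopologicalSpace M]
    [ChartedSpace H M] {F : Type*} [NormedAddCommGroup F] [NormedSpace ℝ F] {k : ℕ}
    (α : Literature.Geometry.Kaehler.closedSmoothForms I M F k)
    (h : Literature.Geometry.Kaehler.deRhamCohomology.mk α = 0) :
    (α : MForm I M F k) ∈ Literature.Geometry.Kaehler.exactSmoothForms I M F k := by
  have h1 : Literature.Geometry.Kaehler.deRhamCohomology.mk α =
      Literature.Geometry.Kaehler.deRhamCohomology.mk 0 := h.trans (map_zero _).symm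
  have h2 := (Literature.Geometry.Kaehler.deRhamCohomology.mk_eq_mk_iff α 0).1 h1
  rwa [Submodule.coe_zero, sub_zero] at h2

/-- A torsion element of a `ℤ`-module has finite additive order (for any `ℤ`-module structure,
read off the hypothesis). [folklore] -/
theorem isOfFinAddOrder_of_mem_torsion {A : Type*} [AddCommGroup A] {inst : Module ℤ A} {x : A}
    (hx : x ∈ @Submodule.torsion ℤ A _ _ inst) : IsOfFinAddOrder x := by
  obtain ⟨⟨m, hm⟩, hmx⟩ := (Submodule.mem_torsion_iff x).1 hx
  refine isOfFinAddOrder_iff_zsmul_eq_zero.2 ⟨m, nonZeroDivisors.ne_zero hm, ?_⟩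
  rw [← Int.cast_smul_eq_zsmul ℤ m x]
  exact hmx

open scoped EuclideanSpace
open Literature.NumberTheory.Transcendental Literature.Geometry.Kaehler
  Literature.Geometry.Symplectic

/-- **STUB S2 (rank-one flat complement).** For a closed connected symplectic `(N, s)` with
`rank H₂(N; ℤ) = 1` and a smoothly embedded compact connected `s`-symplectic surface `B = b(S)`:
(i) `s` is exact on the open complement `U = N ∖ B`, and (ii) every integral `2`-cycle of
`N ∖ B` is torsion in `H₂(N; ℤ)`.  Proof: `H²(N; ℝ)` is a line (`b₂ = 1`, universal
coefficients); the real Poincaré dual `τ = b_! 1` of `b_*[S]` restricts to zero on `N ∖ B`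
(support of Gysin images, `gysinMap_restrictCompl_eq_zero_of_field`) and is non-zero, because
`⟨[s], b_*[S]⟩ = ⟨[b^* s], [S]⟩ ≠ 0` — de Rham's theorem (`integrationDeRhamIsoFamily`, natural)
and `∫_S b^* s ≠ 0` for the nowhere-vanishing area form `b^* s` (Stokes).  Hence the restriction
`H²(N; ℝ) → H²(N ∖ B; ℝ)` vanishes: (i) follows by de Rham's theorem on the open manifold
`U`, (ii) because a non-torsion class of `H₂(N; ℤ)` is detected by an integral class
(Poincaré duality, unimodularity) whose real image would survive on `N ∖ B`.
[cite: McDuffSalamon2017, §2.1 Cor. 2.1.4; Ex. 4.4.5] [cite: HatcherAT2002, §3.3 Thm. 3.30] -/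
theorem stub_rankOneFlatComplement :
    ∀ (N : Type) [TopologicalSpace N] [T2Space N] [SecondCountableTopology N] [CompactSpace N]
      [ConnectedSpace N] [ChartedSpace (EuclideanSpace ℝ (Fin 4)) N] [IsManifold (𝓡 4) ∞ N]
      (s : MForm (𝓡 4) N ℝ 2) (S : Type) [TopologicalSpace S] [T2Space S] [CompactSpace S]
      [ConnectedSpace S] [ChartedSpace (EuclideanSpace ℝ (Fin 2)) S] [IsManifold (𝓡 2) ∞ S]
      (b : S → N),
      IsSmoothForm s → IsClosedForm s →
      (∀ x (v : TangentSpace (𝓡 4) x), v ≠ 0 → ∃ w, s x ![v, w] ≠ 0) →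
      Module.finrank ℤ (singularHomologyZ N 2) = 1 →
      Manifold.IsSmoothEmbedding (𝓡 2) (𝓡 4) ∞ b →
      (∀ y (v : TangentSpace (𝓡 2) y), v ≠ 0 → ∃ w : TangentSpace (𝓡 2) y,
        s (b y) ![mfderiv (𝓡 2) (𝓡 4) b y v, mfderiv (𝓡 2) (𝓡 4) b y w] ≠ 0) →
      (∀ U : Opens N, (U : Set N) = (Set.range b)ᶜ →
        ∃ θ : MForm (𝓡 4) U ℝ 1, IsSmoothForm θ ∧
          mextDeriv θ = s.pullback (𝓡 4) (Subtype.val : U → N)) ∧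
      (∀ x, IsOfFinAddOrder (singularHomology.map ℤ ℤ
        (⟨Subtype.val, continuous_subtype_val⟩ : C(↥(Set.range b)ᶜ, N)) 2 x)) := by
  intro N _ _ _ _ _ _ _ s S _ _ _ _ _ _ b hs hcl hnd hb2 hb hsnd
  have hb2' : Module.finrank ℤ (singularHomology ℤ ℤ N 2) = 1 := hb2
  haveI : LocallyCompactSpace N := ChartedSpace.locallyCompactSpace (EuclideanSpace ℝ (Fin 4)) N
  have hbC : ContMDiff (𝓡 2) (𝓡 4) ∞ b := hb.contMDiff
  set K : Set N := Set.range b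
  have hK : IsClosed K := (isCompact_range hbC.continuous).isClosed
  set ι : C(↥Kᶜ, N) := ⟨Subtype.val, continuous_subtype_val⟩
  set f : C(S, N) := ⟨b, hbC.continuous⟩
  set c : deRhamCohomology (𝓡 4) N ℝ 2 := deRhamCohomology.mk ⟨s, hs, hcl⟩ with hcdef
  -- orientations over `ℝ`, Poincaré duality on `N`, `dim H²(N; ℝ) = 1`
  obtain ⟨μR⟩ := isOrientableOver_of_int_holds N ℝ (isOrientableOver_int_of_nondegenerate s hs hnd)
  obtain ⟨μSR⟩ := isOrientableOver_of_int_holds S ℝ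
    (isOrientableOver_int_surface_of_nondegenerate s hs b hbC hsnd)
  have hPD : μR.HasPoincareDuality :=
    HomologicalOrientation.HasPoincareDuality.of_bijective_poincareDualityMap
      fun p q h ↦ poincare_duality μR h
  have hdim : Module.finrank ℝ (singularCohomology ℝ ℝ N 2) = 1 := by
    rw [finrank_singularCohomology_eq_bettiNumber_of_field, ← bettiNumber_rat_eq_real,
      ← bettiNumber_int_eq_rat]
    exact hb2'
  -- the real Poincaré dual `τ = b_! 1` of `b_*[S]` dies on `N ∖ B`
  set τ : singularCohomology ℝ ℝ N 2 :=
    gysinMap μSR μR f (Nat.zero_add 2) two_add_two_eq_four (singularCohomology.one ℝ S)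
  have hτres : singularCohomology.map ℝ ℝ ι 2 τ = 0 := by
    have hy : singularCohomology.map ℝ ℝ
        (⟨Subtype.val, continuous_subtype_val⟩ : C({y' : S // f y' ∉ K}, S)) 0
        (singularCohomology.one ℝ S) = 0 := by
      haveI : IsEmpty {y' : S // f y' ∉ K} := ⟨fun y ↦ y.2 ⟨y.1, rfl⟩⟩
      haveI := ModuleCat.subsingleton_of_isZero
        (isZero_singularCohomology_of_isEmpty' ℝ {y' : S // f y' ∉ K} 0)
      exact Subsingleton.elim _ _
    exact gysinMap_restrictCompl_eq_zero_of_field ℝ μSR μR hPD f (Nat.zero_add 2)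
      two_add_two_eq_four hK (singularCohomology.one ℝ S) hy
  -- `τ ≠ 0`: the symplectic surface pairs non-trivially with the class of `s`
  have hτ : τ ≠ 0 := by
    haveI : SecondCountableTopology S :=
      ChartedSpace.secondCountable_of_sigmaCompact (EuclideanSpace ℝ (Fin 2)) S
    haveI : LocallyCompactSpace S := ChartedSpace.locallyCompactSpace (EuclideanSpace ℝ (Fin 2)) S
    -- `b^* s` is a nowhere-vanishing area form, hence not exact
    have ht : IsSmoothForm (s.pullback (𝓡 2) b) := isSmoothForm_pullback hbC hs
    have htne : ∀ y, s.pullback (𝓡 2) b y ≠ 0 := fun y h0 ↦ by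
      have hv : ((EuclideanSpace.basisFun (Fin 2) ℝ).toBasis 0 : EuclideanSpace ℝ (Fin 2)) ≠ 0 :=
        Module.Basis.ne_zero _ 0
      obtain ⟨w, hw⟩ := hsnd y ((EuclideanSpace.basisFun (Fin 2) ℝ).toBasis 0) hv
      apply hw
      rw [← pullback_apply_vecTwo, h0]
      rfl
    have htex : s.pullback (𝓡 2) b ∉ exactSmoothForms (𝓡 2) S ℝ 2 :=
      not_mem_exactSmoothForms_of_forall_ne_zero ht htne
    -- so its de Rham class, the pull-back of `c`, is non-zero, also in `H²(S; ℝ)`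
    have hmap : deRhamCohomology.map hbC 2 c ≠ 0 := by
      rw [hcdef, deRhamCohomology.map_mk]
      intro h0
      exact htex (mem_exactSmoothForms_of_mk_eq_zero _ h0)
    have hS : integrationDeRhamIsoFamily (EuclideanSpace ℝ (Fin 2)) S 2
        (deRhamCohomology.map hbC 2 c) ≠ 0 := fun h0 ↦ hmap ((LinearEquiv.map_eq_zero_iff _).1 h0)
    rw [integrationDeRhamIsoFamily_map hbC 2 c] at hS
    -- pairing with `[S]`: `⟨b^* e(c), [S]⟩ = ⟨e(c), b_*[S]⟩ ≠ 0`
    have hpair : kroneckerPairing ℝ ℝ S 2 (singularCohomology.map ℝ ℝ ⟨b, hbC.continuous⟩ 2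
        (integrationDeRhamIsoFamily (EuclideanSpace ℝ (Fin 4)) N 2 c)) μSR.fundamentalClass ≠ 0 :=
      by
      refine fun h0 ↦ hS (kroneckerPairing_fundamentalClass_injective_surface μSR ?_)
      show kroneckerPairing ℝ ℝ S 2 (singularCohomology.map ℝ ℝ ⟨b, hbC.continuous⟩ 2
          (integrationDeRhamIsoFamily (EuclideanSpace ℝ (Fin 4)) N 2 c)) μSR.fundamentalClass =
        kroneckerPairing ℝ ℝ S 2 0 μSR.fundamentalClass
      rw [h0, map_zero, LinearMap.zero_apply]
    rw [kroneckerPairing_map] at hpair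
    -- `τ ⌢ [N] = b_*[S]`
    have hcap : capProduct two_add_two_eq_four τ μR.fundamentalClass =
        singularHomology.map ℝ ℝ f 2 μSR.fundamentalClass :=
      capProduct_gysinMap_one hPD f two_add_two_eq_four
    refine fun hτ0 ↦ hpair ?_
    change kroneckerPairing ℝ ℝ N 2 _ (singularHomology.map ℝ ℝ f 2 μSR.fundamentalClass) = 0
    rw [← hcap, hτ0, map_zero, LinearMap.zero_apply, map_zero]
  -- the restriction `H²(N; ℝ) → H²(N ∖ B; ℝ)` vanishes
  have hres : ∀ y : singularCohomology ℝ ℝ N 2, singularCohomology.map ℝ ℝ ι 2 y = 0 := by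
    intro y
    obtain ⟨r, rfl⟩ := (finrank_eq_one_iff_of_nonzero' τ hτ).1 hdim y
    rw [map_smul, hτres, smul_zero]
  refine ⟨?_, ?_⟩
  · -- (i) `s` is exact on the open complement
    intro U hU
    haveI : LocallyCompactSpace U := ChartedSpace.locallyCompactSpace (EuclideanSpace ℝ (Fin 4)) U
    have hval : ContMDiff (𝓡 4) (𝓡 4) ∞ (Subtype.val : U → N) := contMDiff_subtype_val
    have hmem : ∀ x : U, (x : N) ∈ Kᶜ := fun x ↦ hU ▸ x.2
    set g : C(U, ↥Kᶜ) := ⟨fun x ↦ ⟨x.1, hmem x⟩, continuous_subtype_val.subtype_mk hmem⟩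
    have hg : (⟨Subtype.val, hval.continuous⟩ : C(U, N)) = ι.comp g := rfl
    have hzero : singularCohomology.map ℝ ℝ (⟨Subtype.val, hval.continuous⟩ : C(U, N)) 2
        (integrationDeRhamIsoFamily (EuclideanSpace ℝ (Fin 4)) N 2 c) = 0 := by
      rw [hg, singularCohomology.map_comp, ModuleCat.comp_apply, hres, map_zero]
    have hnat :=
      integrationDeRhamIsoFamily_isNatural (E := EuclideanSpace ℝ (Fin 4)) U N Subtype.val hval 2 c
    rw [hzero, LinearEquiv.map_eq_zero_iff, hcdef, deRhamCohomology.map_mk] at hnat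
    exact exists_eq_mextDeriv_of_mem_exactSmoothForms (mem_exactSmoothForms_of_mk_eq_zero _ hnat)
  · -- (ii) flatness
    intro z
    by_contra hz
    set x := singularHomology.map ℤ ℤ ι 2 z with hxdef
    -- an integral class `β` with `⟨β, x⟩ ≠ 0` (Poincaré duality and unimodularity over `ℤ`)
    obtain ⟨μZ⟩ := isOrientableOver_int_of_nondegenerate s hs hnd
    obtain ⟨a, ha⟩ := (poincare_duality μZ two_add_two_eq_four).2 x
    have hat : (freeCohomology.mk a : freeCohomology ℤ N 2) ≠ 0 := fun h0 ↦ hz <| ha ▸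
      (poincareDualityMap μZ two_add_two_eq_four).toAddMonoidHom.isOfFinAddOrder
        (isOfFinAddOrder_of_mem_torsion ((freeCohomology.mk_eq_zero_iff a).1 h0))
    have hP : (cupPairingModTorsion μZ two_add_two_eq_four).IsPerfPair :=
      isPerfPair_cupPairingModTorsion_holds
    have hne : cupPairingModTorsion μZ two_add_two_eq_four (freeCohomology.mk a) ≠ 0 :=
      fun h0 ↦ hat (hP.bijective_left.1 (h0.trans (map_zero _).symm))
    obtain ⟨b', hb'⟩ : ∃ b',
        cupPairingModTorsion μZ two_add_two_eq_four (freeCohomology.mk a) b' ≠ 0 := by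
      by_contra hall
      exact hne (LinearMap.ext fun b' ↦ not_not.1 (not_exists.1 hall b'))
    obtain ⟨β, rfl⟩ := freeCohomology.mk_surjective b'
    rw [cupPairingModTorsion_mk_mk, cupPairing_eq_kroneckerPairing_poincareDualityMap, ha, hxdef,
      ← kroneckerPairing_map] at hb'
    -- its real image survives on `N ∖ B`, contradicting `hres`
    have h1 := ringChange_ne_zero_of_kroneckerPairing_ne_zero ℝ _ z hb'
    rw [singularCohomology.ringChange_map] at h1
    exact h1 (hres _)

end Lemmas

end Summit.SmoothPoincare4.SmoothPoincare4.Theorems.NoGenusTwoDoor.CanonicalCapFilling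
end
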